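import Summits.BirchSwinnertonDyer.Rank1Residual.GaloisImage.KolyvaginLevelOneUnitCaseOfDictionary
import Summits.BirchSwinnertonDyer.Rank1Residual.GaloisImage.PropagatedConditionCard
import Literature.NumberTheory.GaloisRepresentations.TateDualityCounting
import HarnessLib

/-!
# PORT HYGIENE: the typed dictionary `DICT3₁` is VACUOUSLY inhabited at `t ≥ 1` (witness `κ = 0`)
# — the port's content lives at `t = 0` exactly, where T-a5x consumes it
# (cell `b2b-bsdres`, team n1011, row T-a5x-II addendum (II.7); seat p13)

HONEST FRAMING (cell `b2b-bsdres`, run/shared/lean/b2b/bsd-rank1-residual/, verbatim in every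
file): the goal of the cell is to DELETE the COMBINATION-SHAPED residual classes of the
Birch–Swinnerton-Dyer formula for ALL analytic-rank `≤ 1` elliptic curves over `ℚ` — "full BSD
formula for every rank `≤ 1` curve in class `C`" assembled STRICTLY from published theorems — so
that the rank-`≤ 1` remainder becomes exactly the CONSTRUCTION-SHAPED classes, which are TYPED
(missing-input `Prop`s), NOT attempted. This is not "finishing BSD". Team n1011 (N10/N11, the
additive block `X4 ∧ p = 3`): research route; no claim beyond the stated classes; the label X4 and
the mark of RESIDUAL-MAP §I N11 are UNCHANGED by this file; nothing is booked. Theorems only: a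
SELF-AUDIT of a typed missing-input predicate, not a statement about BSD or about Kato's Euler system.

## What and why

`KatoKuriharaDictionaryThreeOneAt W t D v₃` (p271070, p13; ≡ n1011-p09's `KatoKuriharaDictionaryThreeAt
W 0 t D v₃` by `katoKuriharaDictionaryThreeAt_zero_iff_threeOneAt`, p275780) types [K22] Thm. 3.13 at
the additive prime `3` as: ∃ a family `κ` and a functional `Λ` with (0) Selmer membership, (I4) a
Kolyvagin system congruent to `κ`, (Λ) `Λ` onto `ℤ/3` on `𝓕̄_can(v₃)` with kernel the Kummer part, and
the VALUE CLAUSE `Λ(loc κ_d) = u_d · 3^t · δ̃_{n(d)}`.  At `t ≥ 1` the value clause reads `… = 0`, and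
the ZERO FAMILY `κ = 0` (with `κ' = 0`) satisfies (0), (I4) and every value clause trivially; so the
predicate is inhabited as soon as a functional with property (Λ) exists — which is pure local
structure: `𝒦_{v₃} ≤ 𝓕̄_can(v₃)` (n1011-p18) with index `#𝓕̄/#𝒦 = 9·#E(ℚ₃)[3] / 3·#E(ℚ₃)[3] = 3`
(n1011-p04 T-Lp count from `hEP`; Milne I 3.3), and a character of the `𝔽₃`-space `H¹(ℚ₃, E[3])/𝒦`
non-zero on the line `𝓕̄/𝒦` (`Module.Projective.exists_dual_ne_zero`).  Consequences, honestly: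

* the typed PORT carries NO information at `t ≥ 1` beyond the existence of surjective characters
  `(ℤ/ℓ)ˣ → ℤ/3` at the primes of `D` (its `ψ`-clause) — consistent with, and sharper than, II.4
  (p277568: at `t ≥ 1` the port CERTIFIES nothing); nobody may count an inhabitant of DICT3₁ at
  `t ≥ 1` as progress;
* at `t = 0` the value clause at `d = ∅` with `δ̃_1 = [0]⁺ ≠ 0` forces `κ_∅ ≠ 0`: there the port has
  content, and that is exactly where T-a5x consumes it (p271070 / p275780 / p278115).
For the level spelling `KatoKuriharaDictionaryThreeAt W k t D v₃` the VALUE clauses are likewise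
void whenever `t ≥ k + 1` (the factor `3^t` kills `ℤ/3^(k+1)`); whether its clause (Λ) is inhabited
at levels `k ≥ 1` (cyclicity of `𝓕_can/𝒦` there) is NOT examined here.

* `exists_functional_kummer_kernel_three` — (Λ) is inhabited: from `hEP` at `v₃ ∣ 3` alone there is
  `Λ : H¹(ℚ_{v₃}, E[3]) →+ ℤ/3`, onto on `𝓕̄_can(v₃)`, with `Λ x = 0 ↔ x ∈ 𝒦_{v₃}` on `𝓕̄_can(v₃)`.
* **`katoKuriharaDictionaryThreeOneAt_of_pos`** — `1 ≤ t`, `hEP v₃`, and surjective characters at the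
  primes of `D` ⟹ `KatoKuriharaDictionaryThreeOneAt W t D v₃` (witness `κ = 0`, `κ' = 0`, `u = 1`).

References: C.-H. Kim, AJM 148 (2026) Thm. 3.13, §3.4.1 [Kim2022StructureSelmer]; J. S. Milne,
*ADT* I Lemma 3.3 [MilneADT2006].
-/

noncomputable section

open scoped Classical NumberField ContRepresentation
open Field NumberField IsDedekindDomain
open WeierstrassCurve Literature.NumberTheory.EllipticCurves Literature.NumberTheory.EllipticCurves.ModularForms
  Literature.NumberTheory.EllipticCurves.Rank1Residual
  Literature.NumberTheory.GaloisRepresentations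
  Literature.NumberTheory.GaloisRepresentations.DiscreteGaloisModule Literature.NumberTheory.GaloisCohomology
open Literature.NumberTheory.DiophantineGeometry.Dioph (ratModP)

namespace Summit.BirchSwinnertonDyer.Rank1Residual.GaloisImage

namespace Vacuous

/-- In an additive group, a subgroup of prime order `p` containing a non-zero `y` with `p • y = 0` is
`ℤ∙y`, so each of its elements is an integer multiple of `y`. [folklore] -/
theorem exists_zsmul_eq_of_card_eq_prime {G : Type*} [AddCommGroup G] {p : ℕ} (hp : p.Prime)
    (H : AddSubgroup G) (hH : Nat.card H = p) {y : G} (hy : y ∈ H) (hy0 : y ≠ 0) (hpy : p • y = 0)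
    {x : G} (hx : x ∈ H) : ∃ k : ℤ, k • y = x := by
  haveI : Fact p.Prime := ⟨hp⟩
  haveI : Finite H := Nat.finite_of_card_ne_zero (by rw [hH]; exact hp.ne_zero)
  have hord : addOrderOf y = p := addOrderOf_eq_prime hpy hy0
  have heq : AddSubgroup.zmultiples y = H :=
    AddSubgroup.eq_of_le_of_card_ge ((AddSubgroup.zmultiples_le).mpr hy) (by rw [hH, Nat.card_zmultiples, hord])
  rw [← heq] at hx
  exact AddSubgroup.mem_zmultiples_iff.mp hx

end Vacuous

variable (W : WeierstrassCurve ℚ) [W.IsElliptic]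

/-- **Clause (Λ) of DICT3₁ is inhabited from `hEP` alone.**  At the place `v₃ ∣ 3`:
`𝒦_{v₃} ≤ 𝓕̄_can(v₃)` (n1011-p18) with `#𝓕̄_can(v₃) = 9·#E(ℚ₃)[3]` (n1011-p04 T-Lp, from Tate's local
Euler characteristic) and `#𝒦_{v₃} = 3·#E(ℚ₃)[3]` (Milne I 3.3), so `𝓕̄/𝒦` is a line in the `𝔽₃`-space
`H¹(ℚ₃, E[3])/𝒦`; a linear functional non-zero on it (`Module.Projective.exists_dual_ne_zero`),
composed with the projection, is a `Λ : H¹(ℚ_{v₃}, E[3]) →+ ℤ/3` onto on `𝓕̄_can(v₃)` with kernel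
`𝒦_{v₃}` there.  (This is NOT Kato's `exp*`-functional; only a functional with the same typed shape.)
[cite: MilneADT2006, Ch. I, Lemma 3.3] -/
theorem exists_functional_kummer_kernel_three (v₃ : HeightOneSpectrum (𝓞 ℚ))
    (hv₃ : ((3 : ℕ) : 𝓞 ℚ) ∈ v₃.asIdeal) (hEP : localEulerPoincareCharacteristic (v₃.adicCompletion ℚ)) :
    ∃ Λ : galoisCohomology ((W.torsionGaloisModule ((3 : ℕ) : ℤ)).toLocal (Sum.inr v₃)) 1 →+ ZMod 3,
      (∀ r : ZMod 3, ∃ x ∈ propagatedSelmerStructureOne W 3 (Sum.inr v₃), Λ x = r) ∧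
      (∀ x ∈ propagatedSelmerStructureOne W 3 (Sum.inr v₃),
          Λ x = 0 ↔ x ∈ W.kummerSelmerStructure ((3 : ℕ) : ℤ) (Sum.inr v₃)) := by
  haveI : Fact (Nat.Prime 3) := ⟨Nat.prime_three⟩
  -- notation
  set H := galoisCohomology ((W.torsionGaloisModule ((3 : ℕ) : ℤ)).toLocal (Sum.inr v₃)) 1 with hHdef
  set F : AddSubgroup H := propagatedSelmerStructureOne W 3 (Sum.inr v₃) with hFdef
  set K : AddSubgroup H := W.kummerSelmerStructure ((3 : ℕ) : ℤ) (Sum.inr v₃) with hKdef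
  have hKF : K ≤ F := kummerSelmerStructure_le_propagatedSelmerStructureOne W 3 (Sum.inr v₃)
  -- counts
  set A := Nat.card (nsmulAddMonoidHom 3 : (W.baseChange (v₃.adicCompletion ℚ)).toAffine.Point →+ _).ker
    with hAdef
  have hcardF : Nat.card F = 9 * A := natCard_propagatedSelmerStructureOne_three W v₃ hEP hv₃
  have hcardK : Nat.card K = A * 3 := by
    rw [hKdef, W.natCard_kummerSelmerStructure_inr v₃ (n := 3) (by norm_num), ← hAdef,
      natCard_quot_adicCompletionIntegers_of_prime_mem 3 hv₃]
  haveI hKfin : Finite K := W.finite_kummerSelmerStructure_inr v₃ (n := 3) (by norm_num)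
  have hApos : 0 < A := by
    have h : 0 < Nat.card K := Nat.card_pos
    rw [hcardK] at h
    omega
  haveI hFfin : Finite F := Nat.finite_of_card_ne_zero (by rw [hcardF]; omega)
  -- an element of `F` outside `K`
  obtain ⟨f, hfF, hfK⟩ : ∃ f ∈ F, f ∉ K := by
    by_contra hcon
    push Not at hcon
    have hFK : F = K := le_antisymm hcon hKF
    have h := hcardF
    rw [hFK, hcardK] at h
    omega
  -- `H` is killed by `3`; the quotient `Q = H/K` is an `𝔽₃`-vector space
  have h3H : ∀ x : H, 3 • x = 0 := fun x =>
    nsmul_continuousCohomology_one_eq_zero _ 3 (fun P : geomTorsion W ((3 : ℕ) : ℤ) => by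
      apply Subtype.ext
      rw [AddSubmonoidClass.coe_nsmul, ZeroMemClass.coe_zero, ← natCast_zsmul]
      exact (Submodule.mem_torsionBy_iff _ _).mp P.2) x
  have h3Q : ∀ q : H ⧸ K, 3 • q = 0 := by
    intro q
    induction q using QuotientAddGroup.induction_on with
    | H x => rw [← QuotientAddGroup.mk_nsmul, h3H, QuotientAddGroup.mk_zero]
  letI : Module (ZMod 3) (H ⧸ K) := AddCommGroup.zmodModule h3Q
  -- the class of `f` is non-zero; a functional `φ` with `φ f̄ ≠ 0`
  have hfbar : (QuotientAddGroup.mk f : H ⧸ K) ≠ 0 := fun h => hfK ((QuotientAddGroup.eq_zero_iff f).mp h)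
  obtain ⟨φ, hφ⟩ := Module.Projective.exists_dual_ne_zero (ZMod 3) hfbar
  let Λ : H →+ ZMod 3 := φ.toAddMonoidHom.comp (QuotientAddGroup.mk' K)
  have hΛ : ∀ x : H, Λ x = φ (QuotientAddGroup.mk x) := fun x => rfl
  -- the image of `F` in `Q` has order `3` and is generated by `f̄`
  let g : F →+ H ⧸ K := (QuotientAddGroup.mk' K).comp F.subtype
  have hg : ∀ x : F, g x = QuotientAddGroup.mk (x : H) := fun x => rfl
  have hker : Nat.card g.ker = Nat.card K := by
    refine Nat.card_congr ⟨fun x => ⟨(x : F), ?_⟩, fun y => ⟨⟨(y : H), hKF y.2⟩, ?_⟩, fun x => rfl, fun y => rfl⟩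
    · have hx := x.2
      rw [AddMonoidHom.mem_ker, hg, QuotientAddGroup.eq_zero_iff] at hx
      exact hx
    · rw [AddMonoidHom.mem_ker, hg, QuotientAddGroup.eq_zero_iff]
      exact y.2
  have hrange : Nat.card g.range = 3 := by
    have h := AddSubgroup.card_eq_card_quotient_mul_card_addSubgroup g.ker
    rw [Nat.card_congr (QuotientAddGroup.quotientKerEquivRange g).toEquiv, hker, hcardF, hcardK] at h
    -- `9A = #range · 3A`
    have h' : Nat.card g.range * (A * 3) = 3 * (A * 3) := by rw [← h]; ring
    exact Nat.eq_of_mul_eq_mul_right (by omega) h'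
  have hfrange : (QuotientAddGroup.mk f : H ⧸ K) ∈ g.range := ⟨⟨f, hfF⟩, rfl⟩
  have hmul : ∀ x ∈ F, ∃ k : ℤ, k • (QuotientAddGroup.mk f : H ⧸ K) = QuotientAddGroup.mk x :=
    fun x hx => Vacuous.exists_zsmul_eq_of_card_eq_prime Nat.prime_three g.range hrange hfrange hfbar
      (h3Q _) ⟨⟨x, hx⟩, rfl⟩
  refine ⟨Λ, fun r => ?_, fun x hx => ?_⟩
  · -- surjectivity on `F`: `Λ (c • f) = c · φ f̄`
    refine ⟨(r * (φ (QuotientAddGroup.mk f))⁻¹).val • f, F.nsmul_mem hfF _, ?_⟩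
    rw [hΛ, QuotientAddGroup.mk_nsmul, map_nsmul, nsmul_eq_mul, ZMod.natCast_zmod_val,
      inv_mul_cancel_right₀ hφ]
  · -- kernel clause on `F`
    constructor
    · intro h0
      obtain ⟨k, hk⟩ := hmul x hx
      rw [hΛ, ← hk, map_zsmul, zsmul_eq_mul] at h0
      have hk0 : (k : ZMod 3) = 0 := by
        rcases mul_eq_zero.mp h0 with h | h
        · exact h
        · exact absurd h hφ
      have : (QuotientAddGroup.mk x : H ⧸ K) = 0 := by
        rw [← hk, ← Int.cast_smul_eq_zsmul (ZMod 3), hk0, zero_smul]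
      exact (QuotientAddGroup.eq_zero_iff x).mp this
    · intro hxK
      rw [hΛ, (QuotientAddGroup.eq_zero_iff x).mpr hxK, map_zero]

/-- **DICT3₁ is VACUOUSLY inhabited at `t ≥ 1`** (self-audit of the typed port p271070).  If
`#E(ℚ₃)[3] = 3^t` with `t ≥ 1`, the value clauses `Λ(loc κ_d) = u·3^t·δ̃_{n(d)}` all read `… = 0` in
`ℤ/3`, so the ZERO family (`κ = 0`, `κ' = 0`, `u = 1`) satisfies (0), (I4) and (DICT3); clause (Λ) is
inhabited by `exists_functional_kummer_kernel_three` (from `hEP` at `v₃`); the `ψ`-clause needs a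
surjective character `(ℤ/ℓ)ˣ → ℤ/3` at each prime of `D` (hypothesis `hψ`; it holds at every Kolyvagin
prime `ℓ ≡ 1 (mod 3)`).  HONEST READING: at `t ≥ 1` the predicate asserts nothing about Kato's classes —
consistent with II.4 (p277568: it CERTIFIES nothing there either); the port's content is at `t = 0`,
where `δ̃_1 = [0]⁺ ≠ 0` forces `κ_∅ ≠ 0`, and that is the case T-a5x consumes.  Planner note: in the
level spelling `KatoKuriharaDictionaryThreeAt W k t` the value clauses are likewise void whenever
`t ≥ k + 1` (clause (Λ) at `k ≥ 1` not examined here).  Nothing booked;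
no mark / label changed; no claim about [K22] Thm. 3.13 itself. [cite: Kim2022StructureSelmer, Thm. 3.13 and §3.4.1] -/
theorem katoKuriharaDictionaryThreeOneAt_of_pos [W.IsGloballyMinimal] {t : ℕ} (ht : 1 ≤ t)
    (D : KolyvaginDatum (W.torsionGaloisModule ((3 : ℕ) : ℤ))) (v₃ : HeightOneSpectrum (𝓞 ℚ))
    (hEP : localEulerPoincareCharacteristic (v₃.adicCompletion ℚ))
    (hψ : ∀ q ∈ D.primes, ∃ ψ : (ZMod (Ideal.absNorm q.asIdeal))ˣ →* Multiplicative (ZMod 3),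
      Function.Surjective ψ) :
    KatoKuriharaDictionaryThreeOneAt W t D v₃ := by
  intro _hX _hc3 _h3 _hcard hv₃ N _ P _hManin _hΩ
  obtain ⟨Λ, hΛsurj, hΛker⟩ := exists_functional_kummer_kernel_three W v₃ hv₃ hEP
  refine ⟨0, Λ, fun d _ => zero_mem _, ⟨0, fun d _ => by simp⟩, hΛsurj, hΛker, fun d hd => ?_⟩
  -- the characters: surjective at the primes of `d ⊆ D.primes`, trivial elsewhere
  let ψ : (ℓ : ℕ) → (ZMod ℓ)ˣ →* Multiplicative (ZMod 3) := fun ℓ =>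
    if h : ∃ ψ' : (ZMod ℓ)ˣ →* Multiplicative (ZMod 3), Function.Surjective ψ' then h.choose else 1
  refine ⟨1, ψ, fun q hq => ?_, ?_⟩
  · have h : ∃ ψ' : (ZMod (Ideal.absNorm q.asIdeal))ˣ →* Multiplicative (ZMod 3),
        Function.Surjective ψ' := hψ q (hd hq)
    simp only [ψ, dif_pos h]
    exact h.choose_spec
  · obtain ⟨s, rfl⟩ := Nat.exists_eq_add_of_le ht
    simp only [Pi.zero_apply, map_zero, Units.val_one, one_mul]
    rw [pow_add, pow_one, show (3 : ZMod 3) = 0 from rfl]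
    ring

end Summit.BirchSwinnertonDyer.Rank1Residual.GaloisImage

end
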